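import Summits.QuantumFields.BalabanUV.T4Continuum.Support.ShellMeasureCommutatorVariation

/-!
# `T4Continuum.ShellMeasurePlaquetteStarClosure` — FINDING F-ne7cleaf02g9-1 IN KERNEL: the hypothesis pair
# «every bond's plaquette STAR lies in `Pl`» ∧ «every plaquette of `Pl` has its four boundary bonds IN `Λ`» is
# inhabited ONLY by `Λ = ∅` on `ℤᵈ`, `d ≥ 2` — the live-level (P4) ENDs for OUR action that carry both are VACUOUS
(cell `pub-balaban`, sub-cell `t4`, spine estimate NE7c (node U5b); NE7c ROUND-2 crew, unit
`b2b-balaban-t4-ne7c-formalise-leaf-02` gen 9 — a SELF-AUDIT of this lineage's gen-8 rows S65 (f5d) ∕ S77 on the owner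
table `t4/b2b-balaban-t4-ne7c-p1/LEAVES-NE7c-P1.md` v3.6; ADDITIVE — imports leaf-05-g7's `ShellMeasureCommutatorVariation`
(the star `plaqStar`) ONLY; [folklore]; 0 `def`, 0 `def … : Prop`, 0 sorry, 0 citation tags)

HONEST FRAMING.  Finite four-torus programme, rung (B)+1 only — NOT infinite volume, NOT a mass gap, NOT the Clay
problem, NOT summit progress; (B), `BetaPertHyp`, (B^μ) are not consumed.  NE7c (`T4IndicatorShell.ShellWeightBound`)
is NOT PRINTED in [Balaban 1983–89] and NOT PROVED; «NE7c ⇐ the named binders» (trigger c3, WALL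
`t4/b2b-balaban-t4-ne7c-p1/WALL-NE7c-P1.md` §2b).  ELEMENTARY lattice combinatorics on b08's `Site d = ℤᵈ`; nothing
printed is asserted or cited; no estimate of Bałaban's is discharged; this file REMOVES a claim of ours, it adds none.
HONEST DEPENDENCY (cell): continuum YM on T⁴ ⇐ BetaPertH ∧ nine spine estimates (0/9 proved); BetaPertH ⇐ (D1) ∧ (D4)
∧ CAP+tail; G-an2-4 gates asym, D1 and NE2/3/4.

THE FINDING.  Seven accepted END theorems for OUR η-scaled (39)-split plaquette action —
`ShellMeasurePlaquetteCubicAssembly.prop4Hyp_locGrad_ord₃_oneGrid` (p225763),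
`ShellMeasurePlaquetteCubicAssemblyLevels.prop4Hyp_locGrad_ord₃_eta_levels` (p226095),
`ShellMeasurePlaquetteCubicLocated.located_quad_ord₃_eta_levels` (p226772),
`ShellMeasurePlaquetteCubicLocatedPinned.located_quad_ord₃_oneGrid` ∕ `prop4Hyp_pinned_ord₃_oneGrid` (p227207),
`ShellMeasurePlaquetteCubicLocatedPinnedLevels.prop4Hyp_pinned_ord₃_eta_levels` (p227361),
`ShellMeasurePlaquetteCubicLocatedRowSum.prop4Hyp_pinned_ord₃_eta_levels_explicit` (p227760), and leaf-03-g6's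
`ShellMeasurePlaquetteCubicLocatedStencil.prop4Hyp_{locGrad,pinned}_ord₃_eta_levels_{geom,torusPin}` — take BOTH
* `hst : ∀ b : ↥Λ, plaqStar b.1.1 b.1.2 ⊆ Pl` (the commutator part's summation by parts over the FULL star, (93)), and
* `hbd : ∀ p ∈ Pl, (bd p 0).1 = (p.2.2, p.1) ∧ (bd p 1).1 = (p.2.2 + e p.1, p.2.1) ∧ (bd p 2).1 = (p.2.2 + e p.2.1, p.1) ∧
  (bd p 3).1 = (p.2.2, p.2.1)` with `bd p : Fin 4 → ↥Λ × Bool` (the plaquette word's four letters are `Λ`-bonds).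
Together they close the finite bond set `Λ ⊂ ℤᵈ × Fin d` under `(x, μ) ↦ (x + e_ν, μ)` for every `ν ≠ μ` (§1
`mem_add_e`), hence under `(x, μ) ↦ (x + n·e_ν, μ)` (§1 `mem_add_nsmul_e`), an injective family (§1 `injective_add_nsmul_e`):
* §2 **`eq_empty_of_star_subset_of_bd`**: `2 ≤ d → hst → hbd → Λ = ∅`; `isEmpty_of_star_subset_of_bd`; and for `d ≤ 1`
  **`eq_empty_of_incr`**: the companion hypothesis `hincr : ∀ p ∈ Pl, p.1 < p.2.1` forces `Pl = ∅` (no plaquettes).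
So each of the seven ENDs speaks about the zero space (`d ≥ 2`) or the zero functional (`d ≤ 1`): TRUE BUT VACUOUS as a
statement about a block.  The per-bond lemmas of those files (`weighted_locGrad_cubT_le_located`,
`located_quad_ord₃_eta_levels_kernel`, …, with `{c} (hst : plaqStar c.1.1 c.1.2 ⊆ Pl)` for ONE bond) and every file
WITHOUT the pair (f5c `ShellMeasureCommutatorLevels.prop4Hyp_locGrad_cubT_levels`: star + extension by zero, no `bd`;
f5d-a `ShellMeasurePlaquetteCubicDictionary`; S62∕S63∕S65 f2b∕f4∕J1: incidence counts) are NOT affected.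
WHY (print): [Balaban1985Variational] p. 278 (5) sums `p ⊂ Ω₀` for a domain `Ω₀ ⊂ T_η` (LOCATOR only): bonds of `Ω₀`
next to `Ω₀ᶜ` have INCOMPLETE stars among `{p ⊂ Ω₀}`; by p. 277 (1) `(Lʲη)⁻¹dist(Ω_jᶜ, Ω_{j+1}) > RM₁` they are
level-0 bonds (weight `η`), where the one-grid bound loses NO factor `Lʲ` (locator `XREAD-P4-B11-SectB.md` §3 (k)).
REPAIR (next file of this seat): the star hypothesis becomes the per-bond DICHOTOMY «`plaqStar c ⊆ Pl` OR `wt c ≤ L_b·η`»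
with the naive bound at the lowest-scale bonds, and a NON-VACUITY witness is filed with it.
-/

namespace Summit.QuantumFields.BalabanUV.T4Continuum.ShellMeasurePlaquetteStarClosure

open Literature.MathematicalPhysics.QuantumFieldTheory.Balaban1983to89
open B7Prop1Explicit (e e_apply)
open Summit.QuantumFields.BalabanUV.T4Continuum.ShellMeasureCommutatorVariation
  (plaqStar mem_plaqStar₁ mem_plaqStar₄)

export B7Prop1Explicit (Site)

variable {d : ℕ} {Λ : Finset (Site d × Fin d)} {Pl : Finset (Fin d × Fin d × Site d)} {β : Type*}
  {bd : Fin d × Fin d × Site d → (Fin 4 → ↥Λ × β)}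

/-! ## §1 The closure of `Λ` under unit shifts across a bond -/

/-- Under «stars in `Pl`» and «boundary letters in `Λ`», a `Λ`-bond `⟨x, x + e_μ⟩` drags its parallel neighbour
`⟨x + e_ν, x + e_ν + e_μ⟩` into `Λ` for every `ν ≠ μ` (the plaquette `p_{μν}(x)` resp. `p_{νμ}(x)` lies in the star,
hence in `Pl`, and its third resp. second boundary letter is that neighbour). [folklore] -/
theorem mem_add_e (hst : ∀ b : ↥Λ, plaqStar b.1.1 b.1.2 ⊆ Pl)
    (hbd : ∀ p ∈ Pl, ((bd p 0).1 : Site d × Fin d) = (p.2.2, p.1) ∧ ((bd p 1).1 : Site d × Fin d) = (p.2.2 + e p.1, p.2.1)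
      ∧ ((bd p 2).1 : Site d × Fin d) = (p.2.2 + e p.2.1, p.1) ∧ ((bd p 3).1 : Site d × Fin d) = (p.2.2, p.2.1))
    {x : Site d} {μ ν : Fin d} (hμν : μ ≠ ν) (hx : (x, μ) ∈ Λ) : (x + e ν, μ) ∈ Λ := by
  rcases lt_or_gt_of_ne hμν with h | h
  · -- `p_{μν}(x)` is in the star of `⟨x, x + e_μ⟩`; its third letter is `⟨x + e_ν, ·⟩` in direction `μ`
    have hp : (μ, ν, x) ∈ Pl := hst ⟨(x, μ), hx⟩ (mem_plaqStar₁ h)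
    have h2 := (hbd _ hp).2.2.1
    have hm : (((bd (μ, ν, x) 2).1 : ↥Λ) : Site d × Fin d) ∈ Λ := (bd (μ, ν, x) 2).1.2
    rwa [h2] at hm
  · -- `p_{νμ}(x)` is in the star of `⟨x, x + e_μ⟩`; its second letter is `⟨x + e_ν, ·⟩` in direction `μ`
    have hp : (ν, μ, x) ∈ Pl := hst ⟨(x, μ), hx⟩ (mem_plaqStar₄ h)
    have h1 := (hbd _ hp).2.1
    have hm : (((bd (ν, μ, x) 1).1 : ↥Λ) : Site d × Fin d) ∈ Λ := (bd (ν, μ, x) 1).1.2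
    rwa [h1] at hm

/-- Iterating §1: the whole half-line of parallel bonds `⟨x + n·e_ν, x + n·e_ν + e_μ⟩`, `n ∈ ℕ`, lies in `Λ`. [folklore] -/
theorem mem_add_nsmul_e (hst : ∀ b : ↥Λ, plaqStar b.1.1 b.1.2 ⊆ Pl)
    (hbd : ∀ p ∈ Pl, ((bd p 0).1 : Site d × Fin d) = (p.2.2, p.1) ∧ ((bd p 1).1 : Site d × Fin d) = (p.2.2 + e p.1, p.2.1)
      ∧ ((bd p 2).1 : Site d × Fin d) = (p.2.2 + e p.2.1, p.1) ∧ ((bd p 3).1 : Site d × Fin d) = (p.2.2, p.2.1))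
    {x : Site d} {μ ν : Fin d} (hμν : μ ≠ ν) (hx : (x, μ) ∈ Λ) (n : ℕ) : (x + n • e ν, μ) ∈ Λ := by
  induction n with
  | zero => simpa using hx
  | succ n ih =>
    have h := mem_add_e hst hbd hμν ih
    have heq : x + n • e ν + e ν = x + (n + 1) • e ν := by rw [add_smul, one_smul, add_assoc]
    rwa [heq] at h

omit β bd in
/-- The half-line is an injective family of bonds (read the `ν`-th coordinate: `(x + n·e_ν) ν = x ν + n`). [folklore] -/
theorem injective_add_nsmul_e (x : Site d) (μ ν : Fin d) :
    Function.Injective fun n : ℕ => ((x + n • e ν, μ) : Site d × Fin d) := by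
  intro n m h
  have h1 : x + n • e ν = x + m • e ν := congrArg Prod.fst h
  have h2 : (x + n • e ν) ν = (x + m • e ν) ν := by rw [h1]
  simp only [Pi.add_apply, Pi.smul_apply] at h2
  simpa [e_apply] using h2

/-! ## §2 The vacuity -/

omit β bd in
/-- In dimension `d ≥ 2` every direction has another one. [folklore] -/
theorem exists_ne_dir (hd : 2 ≤ d) (μ : Fin d) : ∃ ν : Fin d, μ ≠ ν := by
  by_cases h : (μ : ℕ) = 0
  · exact ⟨⟨1, by omega⟩, fun heq => by have := congrArg Fin.val heq; simp [h] at this⟩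
  · exact ⟨⟨0, by omega⟩, fun heq => by have := congrArg Fin.val heq; simp at this; exact h this⟩

/-- **THE FINDING (F-ne7cleaf02g9-1) IN KERNEL.**  On `ℤᵈ`, `d ≥ 2`, a FINITE bond set `Λ` whose every bond has its
plaquette star inside `Pl` while every plaquette of `Pl` has its four boundary letters in `Λ` is EMPTY: otherwise §1's
injective half-line of bonds would sit inside the finite set `Λ`.  Consequently the live-level (P4) END theorems listed
in the header, which assume both, are inhabited only at `Λ = ∅`. [folklore] -/
theorem eq_empty_of_star_subset_of_bd (hd : 2 ≤ d) (hst : ∀ b : ↥Λ, plaqStar b.1.1 b.1.2 ⊆ Pl)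
    (hbd : ∀ p ∈ Pl, ((bd p 0).1 : Site d × Fin d) = (p.2.2, p.1) ∧ ((bd p 1).1 : Site d × Fin d) = (p.2.2 + e p.1, p.2.1)
      ∧ ((bd p 2).1 : Site d × Fin d) = (p.2.2 + e p.2.1, p.1) ∧ ((bd p 3).1 : Site d × Fin d) = (p.2.2, p.2.1)) :
    Λ = ∅ := by
  by_contra hne
  obtain ⟨⟨x, μ⟩, hx⟩ := Finset.nonempty_iff_ne_empty.2 hne
  obtain ⟨ν, hμν⟩ := exists_ne_dir hd μ
  have hinf : (Λ : Set (Site d × Fin d)).Infinite :=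
    Set.infinite_of_injective_forall_mem (injective_add_nsmul_e x μ ν)
      (fun n => by exact_mod_cast mem_add_nsmul_e hst hbd hμν hx n)
  exact hinf Λ.finite_toSet

/-- The same, as `IsEmpty ↥Λ` (so every field space `↥Λ → 𝔸` of the listed ENDs is the zero space). [folklore] -/
theorem isEmpty_of_star_subset_of_bd (hd : 2 ≤ d) (hst : ∀ b : ↥Λ, plaqStar b.1.1 b.1.2 ⊆ Pl)
    (hbd : ∀ p ∈ Pl, ((bd p 0).1 : Site d × Fin d) = (p.2.2, p.1) ∧ ((bd p 1).1 : Site d × Fin d) = (p.2.2 + e p.1, p.2.1)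
      ∧ ((bd p 2).1 : Site d × Fin d) = (p.2.2 + e p.2.1, p.1) ∧ ((bd p 3).1 : Site d × Fin d) = (p.2.2, p.2.1)) :
    IsEmpty ↥Λ := by
  rw [eq_empty_of_star_subset_of_bd hd hst hbd]
  infer_instance

/-- Under the same pair, every function on the bonds of `Λ` is the zero function's equal: the source and target
spaces of the listed `Prop4Hyp` conclusions are SUBSINGLETONS (`d ≥ 2`). [folklore] -/
theorem subsingleton_fields_of_star_subset_of_bd (hd : 2 ≤ d) (hst : ∀ b : ↥Λ, plaqStar b.1.1 b.1.2 ⊆ Pl)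
    (hbd : ∀ p ∈ Pl, ((bd p 0).1 : Site d × Fin d) = (p.2.2, p.1) ∧ ((bd p 1).1 : Site d × Fin d) = (p.2.2 + e p.1, p.2.1)
      ∧ ((bd p 2).1 : Site d × Fin d) = (p.2.2 + e p.2.1, p.1) ∧ ((bd p 3).1 : Site d × Fin d) = (p.2.2, p.2.1))
    (𝔸 : Type*) : Subsingleton (↥Λ → 𝔸) := by
  haveI := isEmpty_of_star_subset_of_bd hd hst hbd
  infer_instance

omit β bd Λ in
/-- The low-dimensional companion: for `d ≤ 1` there is no increasing direction pair, so the companion hypothesis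
`hincr : ∀ p ∈ Pl, p.1 < p.2.1` of the same ENDs forces `Pl = ∅` — the action is the empty sum. [folklore] -/
theorem eq_empty_of_incr (hd : d ≤ 1) (hincr : ∀ p ∈ Pl, p.1 < p.2.1) : Pl = ∅ := by
  by_contra hne
  obtain ⟨p, hp⟩ := Finset.nonempty_iff_ne_empty.2 hne
  have h := hincr p hp
  have h1 : (p.2.1 : ℕ) < d := p.2.1.isLt
  have h2 : (p.1 : ℕ) < (p.2.1 : ℕ) := h
  omega

/-- **EITHER WAY.**  For every `d`: the triple (`hincr`, `hst`, `hbd`) of the listed ENDs forces `Λ = ∅ ∨ Pl = ∅`.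
[folklore] -/
theorem empty_or_empty (hincr : ∀ p ∈ Pl, p.1 < p.2.1) (hst : ∀ b : ↥Λ, plaqStar b.1.1 b.1.2 ⊆ Pl)
    (hbd : ∀ p ∈ Pl, ((bd p 0).1 : Site d × Fin d) = (p.2.2, p.1) ∧ ((bd p 1).1 : Site d × Fin d) = (p.2.2 + e p.1, p.2.1)
      ∧ ((bd p 2).1 : Site d × Fin d) = (p.2.2 + e p.2.1, p.1) ∧ ((bd p 3).1 : Site d × Fin d) = (p.2.2, p.2.1)) :
    Λ = ∅ ∨ Pl = ∅ := by
  by_cases hd : 2 ≤ d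
  · exact Or.inl (eq_empty_of_star_subset_of_bd hd hst hbd)
  · exact Or.inr (eq_empty_of_incr (by omega) hincr)

end Summit.QuantumFields.BalabanUV.T4Continuum.ShellMeasurePlaquetteStarClosure
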